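import Mathlib
import Summits.ResolutionOfSingularities.ResolutionOfSingularities.Theorems.WildQuotientsWildQuotientResolutionS1aInducedTorusRing

/-!
# The induced-torus ring is of finite type over `k`
(crux stmt-ResolutionOfSingularities-17941 `WildQuotients.CyclicQuotientFourfolds`, line B `s1a-tamebr`, (S1)
`S1.TameToBR.InducedTorusStatement`; plan-1 ASSIGN 2026-08-27T19:48:55Z. [OURS · L1 W4.5c] — NOT statements of
the manuscript; counted 0. Owner res-L1-w45c-stub-4 (gen 5).)

If `B` is of finite type over `k` and graded by `Π j, ZMod (r j)`, the induced-torus ring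
`R = ⊕_{λ ∈ ℤᵐ} 𝒜(λ mod r)` is of finite type over `k`: it is generated by the homogeneous components `g_t` of
a finite generating set of `B`, placed in degrees `λ_t` lifting their `B`-degrees, together with the units
`y^{± r_j 𝐞_j}` (`1 ∈ 𝒜 0` placed in the degrees `± r_j 𝐞_j` of the kernel lattice of `λ ↦ λ mod r`):
a homogeneous `a ∈ 𝒜(λ mod r)` is a polynomial in the `g_t`; its weight-`μ` components with `μ ≡ λ (mod r)` are
combinations of monomials in the placed generators, and `λ − μ` lies in the kernel lattice.
* `InducedTorus.aeval_mem_pull`, `InducedTorus.exists_prod_of_pow_eq`, `InducedTorus.of_aeval_mem`,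
  `InducedTorus.of_one_mem_of_ker`, **`InducedTorus.finiteType`**.
-/

set_option linter.dupNamespace false

noncomputable section

open DirectSum MvPolynomial

namespace Summit.ResolutionOfSingularities.ResolutionOfSingularities.Theorems.WildQuotientResolution.S1.InducedTorus

variable {m : ℕ} (r : Fin m → ℕ) {k : Type} [Field k] {B : Type} [CommRing B] [Algebra k B]
  (𝒜 : (Π j : Fin m, ZMod (r j)) → Submodule k B) [GradedAlgebra 𝒜]

/-- A section of `torusDeg`. [OURS · L1 W4.5c] -/
def sect (d : Π j : Fin m, ZMod (r j)) : Fin m → ℤ := fun j => ((d j).cast : ℤ)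

omit [GradedAlgebra 𝒜] in
/-- `torusDeg (sect d) = d`. [OURS · L1 W4.5c] -/
@[simp] theorem torusDeg_sect (d : Π j : Fin m, ZMod (r j)) : torusDeg r (sect r d) = d :=
  funext fun j => by rw [torusDeg_apply]; exact ZMod.intCast_zmod_cast (d j)

omit [GradedAlgebra 𝒜] in
/-- The weight of an exponent as a finite sum. [folklore] -/
theorem weight_eq_finset_sum {T : Type} (w : T → (Fin m → ℤ)) (d : T →₀ ℕ) :
    Finsupp.weight w d = ∑ t ∈ d.support, d t • w t := by
  rw [Finsupp.weight_apply, Finsupp.sum]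

/-! ## Placing polynomials in homogeneous generators -/

section Place

variable {T : Type} (w : T → (Fin m → ℤ)) (b : T → B) (hb : ∀ t, b t ∈ pull r 𝒜 (w t))
include hb

/-- A monomial in the generators is homogeneous of the weight of its exponent. [folklore] -/
theorem prod_pow_mem_pull (d : T →₀ ℕ) : ∏ t ∈ d.support, b t ^ d t ∈ pull r 𝒜 (Finsupp.weight w d) := by
  rw [weight_eq_finset_sum]
  exact SetLike.prod_pow_mem_graded (A := pull r 𝒜) (i := w) (g := b) (F := d.support) (fun t => d t)
    (fun t _ => hb t)

/-- **Weighted-homogeneous polynomials in homogeneous elements are homogeneous**: if `b t ∈ 𝒜(w t mod r)` and `Q`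
is weighted-homogeneous of weight `μ` for `w`, then `aeval b Q ∈ 𝒜(μ mod r)`. [folklore] -/
theorem aeval_mem_pull (Q : MvPolynomial T k) (μ : Fin m → ℤ) (hQ : IsWeightedHomogeneous w Q μ) :
    aeval b Q ∈ pull r 𝒜 μ := by
  classical
  rw [Q.as_sum, map_sum]
  refine Submodule.sum_mem _ fun d hd => ?_
  have hwd : Finsupp.weight w d = μ := hQ (mem_support_iff.mp hd)
  rw [aeval_monomial, Finsupp.prod, ← Algebra.smul_def]
  refine Submodule.smul_mem _ _ ?_
  rw [← hwd]
  exact prod_pow_mem_pull r 𝒜 w b hb d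

/-- **Products of powers of the placed generators**: `∏_t (b_t placed in degree w_t)^{n_t}` is `∏ b_t^{n_t}`
placed in degree `μ = Σ n_t • w_t`. [OURS · L1 W4.5c] -/
theorem exists_prod_of_pow_eq (F : Finset T) (n : T → ℕ) (μ : Fin m → ℤ) (hμ : ∑ t ∈ F, n t • w t = μ) :
    ∃ h : (∏ t ∈ F, b t ^ n t) ∈ pull r 𝒜 μ,
      ∏ t ∈ F, DirectSum.of (fun ν => ↥(pull r 𝒜 ν)) (w t) ⟨b t, hb t⟩ ^ n t =
        DirectSum.of (fun ν => ↥(pull r 𝒜 ν)) μ ⟨∏ t ∈ F, b t ^ n t, h⟩ := by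
  classical
  subst hμ
  refine ⟨SetLike.prod_pow_mem_graded (A := pull r 𝒜) (i := w) (g := b) (F := F) n (fun t _ => hb t), ?_⟩
  induction F using Finset.induction_on with
  | empty =>
    rw [Finset.prod_empty]
    exact (DirectSum.one_def _).trans (DirectSum.of_eq_of_gradedMonoid_eq
      (Sigma.subtype_ext (show (0 : Fin m → ℤ) = ∑ t ∈ (∅ : Finset T), n t • w t by rw [Finset.sum_empty])
        (show (1 : B) = ∏ t ∈ (∅ : Finset T), b t ^ n t by rw [Finset.prod_empty])))
  | insert a F ha ih =>
    conv_lhs => rw [Finset.prod_insert ha, ih, DirectSum.ofPow, DirectSum.of_mul_of (A := fun ν => ↥(pull r 𝒜 ν))]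
    exact DirectSum.of_eq_of_gradedMonoid_eq (Sigma.subtype_ext
      (show n a • w a + ∑ t ∈ F, n t • w t = ∑ t ∈ insert a F, n t • w t by rw [Finset.sum_insert ha])
      (show b a ^ n a * ∏ t ∈ F, b t ^ n t = ∏ t ∈ insert a F, b t ^ n t by rw [Finset.prod_insert ha]))

/-- The placed value of a weighted-homogeneous polynomial in the placed generators lies in any subalgebra
containing the placed generators. [OURS · L1 W4.5c] -/
theorem of_aeval_mem (S : Subalgebra k (InducedRing r 𝒜))
    (hS : ∀ t, DirectSum.of (fun μ => ↥(pull r 𝒜 μ)) (w t) ⟨b t, hb t⟩ ∈ S)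
    (Q : MvPolynomial T k) (μ : Fin m → ℤ) (hQ : IsWeightedHomogeneous w Q μ) :
    DirectSum.of (fun ν => ↥(pull r 𝒜 ν)) μ ⟨aeval b Q, aeval_mem_pull r 𝒜 w b hb Q μ hQ⟩ ∈ S := by
  classical
  -- the monomials of `Q`, placed
  have hmono : ∀ d ∈ Q.support, ∃ hd : (∏ t ∈ d.support, b t ^ d t) ∈ pull r 𝒜 μ,
      DirectSum.of (fun ν => ↥(pull r 𝒜 ν)) μ ⟨∏ t ∈ d.support, b t ^ d t, hd⟩ ∈ S := by
    intro d hd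
    have hwd : Finsupp.weight w d = μ := hQ (mem_support_iff.mp hd)
    obtain ⟨h, e⟩ := exists_prod_of_pow_eq r 𝒜 w b hb d.support (fun t => d t) μ
      (by rw [← weight_eq_finset_sum, hwd])
    exact ⟨h, e ▸ Subalgebra.prod_mem _ fun t _ => Subalgebra.pow_mem _ (hS t) _⟩
  -- `⟨aeval b Q, _⟩ = Σ_d coeff_d • ⟨monomial_d, _⟩` in `pull μ`
  let e : (T →₀ ℕ) → ↥(pull r 𝒜 μ) := fun d =>
    if hd : d ∈ Q.support then coeff d Q • ⟨∏ t ∈ d.support, b t ^ d t, (hmono d hd).1⟩ else 0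
  have hsum : (⟨aeval b Q, aeval_mem_pull r 𝒜 w b hb Q μ hQ⟩ : ↥(pull r 𝒜 μ)) = ∑ d ∈ Q.support, e d := by
    apply Subtype.ext
    rw [AddSubmonoidClass.coe_finsetSum]
    change aeval b Q = _
    conv_lhs => rw [Q.as_sum, map_sum]
    refine Finset.sum_congr rfl fun d hd => ?_
    simp only [e, dif_pos hd, Submodule.coe_smul]
    rw [aeval_monomial, Finsupp.prod, Algebra.smul_def]
  rw [hsum, map_sum]
  refine Subalgebra.sum_mem _ fun d hd => ?_
  simp only [e, dif_pos hd]
  rw [← DirectSum.lof_eq_of k, map_smul, DirectSum.lof_eq_of]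
  exact Subalgebra.smul_mem _ (hmono d hd).2 _

end Place

/-! ## The kernel lattice: `y^ν` for `ν ≡ 0` -/

/-- `1` placed in a kernel degree. [OURS · L1 W4.5c] -/
theorem one_mem_pull_of_ker (ν : Fin m → ℤ) (hν : torusDeg r ν = 0) : (1 : B) ∈ pull r 𝒜 ν := by
  rw [mem_pull_iff, hν]; exact SetLike.one_mem_graded 𝒜

/-- The kernel degrees `r_j 𝐞_j`. [OURS · L1 W4.5c] -/
theorem torusDeg_single (j : Fin m) (c : ℤ) :
    torusDeg r (Pi.single j ((r j : ℤ) * c)) = 0 := by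
  funext i
  rw [torusDeg_apply, Pi.zero_apply]
  by_cases h : i = j
  · subst h; rw [Pi.single_eq_same, Int.cast_mul, Int.cast_natCast, ZMod.natCast_self, zero_mul]
  · rw [Pi.single_eq_of_ne h, Int.cast_zero]

/-- Kernel degrees are sums of multiples of the `r_j 𝐞_j`. [OURS · L1 W4.5c] -/
theorem eq_sum_single_of_ker (ν : Fin m → ℤ) (hν : torusDeg r ν = 0) :
    ∃ c : Fin m → ℤ, ν = ∑ j, Pi.single j ((r j : ℤ) * c j) := by
  have hdvd : ∀ j, (r j : ℤ) ∣ ν j := fun j =>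
    (ZMod.intCast_zmod_eq_zero_iff_dvd (ν j) (r j)).mp (by have := congrFun hν j; rwa [torusDeg_apply] at this)
  choose c hc using hdvd
  refine ⟨c, funext fun i => ?_⟩
  rw [Finset.sum_apply, Finset.sum_eq_single i (fun j _ hj => by rw [Pi.single_eq_of_ne (Ne.symm hj)])
    (fun h => absurd (Finset.mem_univ i) h), Pi.single_eq_same]
  exact hc i

/-- **`y^ν` for `ν` in the kernel lattice lies in any subalgebra containing `y^{± r_j 𝐞_j}`.** [OURS · L1 W4.5c] -/
theorem of_one_mem_of_ker (S : Subalgebra k (InducedRing r 𝒜))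
    (hS : ∀ (j : Fin m) (c : ℤ), DirectSum.of (fun μ => ↥(pull r 𝒜 μ)) (Pi.single j ((r j : ℤ) * c))
      ⟨1, one_mem_pull_of_ker r 𝒜 _ (torusDeg_single r j c)⟩ ∈ S)
    (ν : Fin m → ℤ) (hν : torusDeg r ν = 0) :
    DirectSum.of (fun μ => ↥(pull r 𝒜 μ)) ν ⟨1, one_mem_pull_of_ker r 𝒜 ν hν⟩ ∈ S := by
  classical
  obtain ⟨c, rfl⟩ := eq_sum_single_of_ker r ν hν
  -- induction over the finite sum, carrying the membership proof
  suffices h : ∀ F : Finset (Fin m), ∃ hF : (1 : B) ∈ pull r 𝒜 (∑ j ∈ F, Pi.single j ((r j : ℤ) * c j)),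
      DirectSum.of (fun μ => ↥(pull r 𝒜 μ)) (∑ j ∈ F, Pi.single j ((r j : ℤ) * c j)) ⟨1, hF⟩ ∈ S by
    obtain ⟨hF, h⟩ := h Finset.univ
    exact h
  intro F
  induction F using Finset.induction_on with
  | empty =>
    refine ⟨by rw [Finset.sum_empty]; exact one_mem_pull_of_ker r 𝒜 0 (map_zero _), ?_⟩
    have : DirectSum.of (fun μ => ↥(pull r 𝒜 μ)) (∑ j ∈ (∅ : Finset (Fin m)), Pi.single j ((r j : ℤ) * c j))
        ⟨1, by rw [Finset.sum_empty]; exact one_mem_pull_of_ker r 𝒜 0 (map_zero _)⟩ = 1 := by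
      rw [DirectSum.one_def]
      exact DirectSum.of_eq_of_gradedMonoid_eq (Sigma.subtype_ext
        (show ∑ j ∈ (∅ : Finset (Fin m)), Pi.single j ((r j : ℤ) * c j) = (0 : Fin m → ℤ) by
          rw [Finset.sum_empty]) (show (1 : B) = 1 from rfl))
    rw [this]; exact Subalgebra.one_mem _
  | insert a F ha ih =>
    obtain ⟨hF, hmem⟩ := ih
    have hF' : (1 : B) ∈ pull r 𝒜 (∑ j ∈ insert a F, Pi.single j ((r j : ℤ) * c j)) := by
      rw [Finset.sum_insert ha]
      have h := SetLike.mul_mem_graded (one_mem_pull_of_ker r 𝒜 _ (torusDeg_single r a (c a))) hF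
      rwa [one_mul] at h
    refine ⟨hF', ?_⟩
    have e : DirectSum.of (fun μ => ↥(pull r 𝒜 μ)) (∑ j ∈ insert a F, Pi.single j ((r j : ℤ) * c j)) ⟨1, hF'⟩ =
        DirectSum.of (fun μ => ↥(pull r 𝒜 μ)) (Pi.single a ((r a : ℤ) * c a))
          ⟨1, one_mem_pull_of_ker r 𝒜 _ (torusDeg_single r a (c a))⟩ *
        DirectSum.of (fun μ => ↥(pull r 𝒜 μ)) (∑ j ∈ F, Pi.single j ((r j : ℤ) * c j)) ⟨1, hF⟩ := by
      rw [DirectSum.of_mul_of (A := fun μ => ↥(pull r 𝒜 μ))]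
      exact DirectSum.of_eq_of_gradedMonoid_eq (Sigma.subtype_ext
        (show ∑ j ∈ insert a F, Pi.single j ((r j : ℤ) * c j) =
            Pi.single a ((r a : ℤ) * c a) + ∑ j ∈ F, Pi.single j ((r j : ℤ) * c j) from Finset.sum_insert ha)
        (show (1 : B) = 1 * 1 from (one_mul 1).symm))
    rw [e]
    exact Subalgebra.mul_mem _ (hS a (c a)) hmem

/-! ## Finite type -/

/-- Decomposition of a homogeneous element of `B` written as a polynomial in homogeneous generators: only the
weighted components of congruent weight contribute. [OURS · L1 W4.5c] -/
theorem eq_sum_filter_aeval_component {T : Type} (w : T → (Fin m → ℤ)) (b : T → B)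
    (hb : ∀ t, b t ∈ pull r 𝒜 (w t)) (P : MvPolynomial T k) (l : Fin m → ℤ)
    (ha : aeval b P ∈ pull r 𝒜 l) :
    aeval b P = ∑ μ ∈ (Finset.image (Finsupp.weight w) P.support).filter (fun μ => torusDeg r μ = torusDeg r l),
      aeval b (weightedHomogeneousComponent w μ P) := by
  classical
  set M := Finset.image (Finsupp.weight w) P.support with hM
  have hP : P = ∑ μ ∈ M, weightedHomogeneousComponent w μ P := by
    conv_lhs => rw [← sum_weightedHomogeneousComponent w P]
    exact finsum_eq_sum_of_support_subset _ (fun μ hμ => by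
      by_contra hμM
      exact hμ (weightedHomogeneousComponent_eq_zero_of_notMem w P μ hμM))
  have hc : ∀ μ, aeval b (weightedHomogeneousComponent w μ P) ∈ 𝒜 (torusDeg r μ) := fun μ =>
    aeval_mem_pull r 𝒜 w b hb _ μ (weightedHomogeneousComponent_isWeightedHomogeneous (w := w) μ P)
  -- compare the `torusDeg l`-components in `B`
  have key : (DirectSum.decompose 𝒜 (aeval b P) (torusDeg r l) : B) =
      ∑ μ ∈ M, (DirectSum.decompose 𝒜 (aeval b (weightedHomogeneousComponent w μ P)) (torusDeg r l) : B) := by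
    rw [← GradedRing.proj_apply]
    conv_lhs => rw [hP, map_sum, map_sum]
    exact Finset.sum_congr rfl fun μ _ => GradedRing.proj_apply 𝒜 _ _
  rw [DirectSum.decompose_of_mem_same 𝒜 ha] at key
  rw [key, Finset.sum_filter]
  refine Finset.sum_congr rfl fun μ _ => ?_
  by_cases h : torusDeg r μ = torusDeg r l
  · rw [if_pos h, ← h, DirectSum.decompose_of_mem_same 𝒜 (hc μ)]
  · rw [if_neg h, DirectSum.decompose_of_mem_ne 𝒜 (hc μ) h]

omit [GradedAlgebra 𝒜] in
/-- `n • (c r_j 𝐞_j) = (n c) r_j 𝐞_j`. [folklore] -/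
theorem nsmul_single (j : Fin m) (n : ℕ) (c : ℤ) :
    n • (Pi.single j ((r j : ℤ) * c) : Fin m → ℤ) = Pi.single j ((r j : ℤ) * ((n : ℤ) * c)) := by
  funext i
  rw [Pi.smul_apply, nsmul_eq_mul]
  by_cases h : i = j
  · subst h; rw [Pi.single_eq_same, Pi.single_eq_same]; ring
  · rw [Pi.single_eq_of_ne h, Pi.single_eq_of_ne h, mul_zero]

-- the assembly is long; the kernel part and the component part are the two lemmas above
set_option maxHeartbeats 800000 in
/-- **The induced-torus ring is of finite type over `k`** (for `B` of finite type). [OURS · L1 W4.5c] -/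
theorem finiteType [Algebra.FiniteType k B] : Algebra.FiniteType k (InducedRing r 𝒜) := by
  classical
  -- homogeneous generators of `B`
  obtain ⟨G, hG⟩ := (‹Algebra.FiniteType k B›).out
  let Gh : Finset B := G.biUnion fun g => ((DirectSum.decompose 𝒜 g).support).image
    fun δ => (DirectSum.decompose 𝒜 g δ : B)
  have hGh : ∀ b ∈ Gh, ∃ δ, b ∈ 𝒜 δ := by
    intro b hb
    obtain ⟨g, -, hg⟩ := Finset.mem_biUnion.mp hb
    obtain ⟨δ, -, rfl⟩ := Finset.mem_image.mp hg
    exact ⟨δ, (DirectSum.decompose 𝒜 g δ).2⟩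
  choose! deg hdeg using hGh
  have hadjB : Algebra.adjoin k (Gh : Set B) = ⊤ := by
    apply top_le_iff.mp
    rw [← hG]
    refine Algebra.adjoin_le fun g hg => ?_
    rw [← DirectSum.sum_support_decompose 𝒜 g]
    refine Subalgebra.sum_mem _ fun δ hδ => Algebra.subset_adjoin ?_
    exact Finset.mem_biUnion.mpr ⟨g, hg, Finset.mem_image.mpr ⟨δ, hδ, rfl⟩⟩
  -- the placed generators
  let T := ↥Gh
  let b : T → B := fun t => (t : B)
  let w : T → (Fin m → ℤ) := fun t => sect r (deg (t : B))
  have hb : ∀ t, b t ∈ pull r 𝒜 (w t) := fun t => by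
    rw [mem_pull_iff, torusDeg_sect]; exact hdeg _ t.2
  let genT : T → InducedRing r 𝒜 := fun t => DirectSum.of (fun μ => ↥(pull r 𝒜 μ)) (w t) ⟨b t, hb t⟩
  let genY : Fin m × Bool → InducedRing r 𝒜 := fun jc =>
    DirectSum.of (fun μ => ↥(pull r 𝒜 μ)) (Pi.single jc.1 ((r jc.1 : ℤ) * (if jc.2 then 1 else -1)))
      ⟨1, one_mem_pull_of_ker r 𝒜 _ (torusDeg_single r jc.1 _)⟩
  let S : Subalgebra k (InducedRing r 𝒜) := Algebra.adjoin k (Set.range genT ∪ Set.range genY)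
  have hST : ∀ t, genT t ∈ S := fun t => Algebra.subset_adjoin (Or.inl ⟨t, rfl⟩)
  have hSY : ∀ jc, genY jc ∈ S := fun jc => Algebra.subset_adjoin (Or.inr ⟨jc, rfl⟩)
  -- `y^{c r_j 𝐞_j} ∈ S` for every integer `c`
  have hSker : ∀ (j : Fin m) (c : ℤ), DirectSum.of (fun μ => ↥(pull r 𝒜 μ)) (Pi.single j ((r j : ℤ) * c))
      ⟨1, one_mem_pull_of_ker r 𝒜 _ (torusDeg_single r j c)⟩ ∈ S := by
    intro j c
    -- `c = n • (±1)`
    obtain ⟨n, s, rfl⟩ : ∃ (n : ℕ) (s : Bool), c = (n : ℤ) * (if s then 1 else -1) := by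
      rcases le_or_gt 0 c with hc | hc
      · exact ⟨c.toNat, true, by rw [if_pos rfl, mul_one, Int.toNat_of_nonneg hc]⟩
      · exact ⟨(-c).toNat, false, by rw [if_neg Bool.false_ne_true, Int.toNat_of_nonneg (by omega)]; ring⟩
    have hpow : ∃ h, genY (j, s) ^ n = DirectSum.of (fun μ => ↥(pull r 𝒜 μ))
        (Pi.single j ((r j : ℤ) * ((n : ℤ) * (if s then 1 else -1)))) ⟨1, h⟩ := by
      refine ⟨one_mem_pull_of_ker r 𝒜 _ (torusDeg_single r j _), ?_⟩
      simp only [genY]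
      rw [DirectSum.ofPow]
      exact DirectSum.of_eq_of_gradedMonoid_eq (Sigma.subtype_ext (nsmul_single r j n _) (one_pow n))
    obtain ⟨h, e⟩ := hpow
    rw [← e]
    exact Subalgebra.pow_mem _ (hSY (j, s)) n
  refine ⟨⟨(Finset.univ.image genT) ∪ (Finset.univ.image genY), ?_⟩⟩
  rw [Finset.coe_union, Finset.coe_image, Finset.coe_image, Finset.coe_univ, Finset.coe_univ, Set.image_univ,
    Set.image_univ]
  change S = ⊤
  suffices hall : ∀ x : InducedRing r 𝒜, x ∈ S from top_le_iff.mp fun x _ => hall x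
  intro x
  -- every element of the induced-torus ring lies in `S`
  induction x using DirectSum.induction_on with
  | zero => exact Subalgebra.zero_mem _
  | add x y hx hy => exact Subalgebra.add_mem _ hx hy
  | of l a =>
    -- write `a` as a polynomial in the homogeneous generators
    have ha' : (a : B) ∈ (MvPolynomial.aeval (R := k) b).range := by
      rw [← Algebra.adjoin_range_eq_range_aeval, show Set.range b = (Gh : Set B) from Subtype.range_coe, hadjB]
      trivial
    obtain ⟨P, hP⟩ := ha'
    have hP' : aeval b P = (a : B) := hP
    have haP : aeval b P ∈ pull r 𝒜 l := by rw [hP']; exact a.2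
    let Mf := (Finset.image (Finsupp.weight w) P.support).filter fun μ => torusDeg r μ = torusDeg r l
    have hc : ∀ μ, aeval b (weightedHomogeneousComponent w μ P) ∈ pull r 𝒜 μ := fun μ =>
      aeval_mem_pull r 𝒜 w b hb _ μ (weightedHomogeneousComponent_isWeightedHomogeneous (w := w) μ P)
    have hcl : ∀ μ ∈ Mf, aeval b (weightedHomogeneousComponent w μ P) ∈ pull r 𝒜 l := by
      intro μ hμ
      have h := (Finset.mem_filter.mp hμ).2
      rw [mem_pull_iff, ← h]; exact hc μ
    -- `a = Σ_{μ ∈ Mf} ⟨c_μ, _⟩` in `pull l`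
    let cμ : (Fin m → ℤ) → ↥(pull r 𝒜 l) := fun μ =>
      if hμ : μ ∈ Mf then ⟨aeval b (weightedHomogeneousComponent w μ P), hcl μ hμ⟩ else 0
    have hasum : a = ∑ μ ∈ Mf, cμ μ := by
      apply Subtype.ext
      rw [AddSubmonoidClass.coe_finsetSum]
      have : (a : B) = aeval b P := hP'.symm
      rw [this, eq_sum_filter_aeval_component r 𝒜 w b hb P l haP]
      refine Finset.sum_congr rfl fun μ hμ => ?_
      simp only [cμ, dif_pos hμ]
    rw [hasum, map_sum]
    refine Subalgebra.sum_mem _ fun μ hμ => ?_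
    simp only [cμ, dif_pos hμ]
    -- `⟨c_μ⟩ in degree l = y^{l - μ} · (c_μ in degree μ)`
    have hker : torusDeg r (l - μ) = 0 := by rw [map_sub, (Finset.mem_filter.mp hμ).2, sub_self]
    have e : DirectSum.of (fun ν => ↥(pull r 𝒜 ν)) l ⟨aeval b (weightedHomogeneousComponent w μ P), hcl μ hμ⟩ =
        DirectSum.of (fun ν => ↥(pull r 𝒜 ν)) (l - μ) ⟨1, one_mem_pull_of_ker r 𝒜 _ hker⟩ *
        DirectSum.of (fun ν => ↥(pull r 𝒜 ν)) μ ⟨aeval b (weightedHomogeneousComponent w μ P),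
          aeval_mem_pull r 𝒜 w b hb _ μ (weightedHomogeneousComponent_isWeightedHomogeneous (w := w) μ P)⟩ := by
      rw [DirectSum.of_mul_of (A := fun ν => ↥(pull r 𝒜 ν))]
      exact DirectSum.of_eq_of_gradedMonoid_eq (Sigma.subtype_ext (sub_add_cancel l μ).symm (one_mul _).symm)
    rw [e]
    exact Subalgebra.mul_mem _ (of_one_mem_of_ker r 𝒜 S hSker _ hker)
      (of_aeval_mem r 𝒜 w b hb S hST _ μ (weightedHomogeneousComponent_isWeightedHomogeneous (w := w) μ P))

end Summit.ResolutionOfSingularities.ResolutionOfSingularities.Theorems.WildQuotientResolution.S1.InducedTorus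

end
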